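import Summits.NavierStokesRegularity.NavierStokesRegularity.Theorems.ScenarioCensusParityMeter
import Summits.NavierStokesRegularity.NavierStokesRegularity.Theorems.ScenarioCensusRoughnessMeterRows
import Summits.NavierStokesRegularity.NavierStokesRegularity.Theorems.ScenarioCensusDeviatorMeterStress
import HarnessLib

/-!
# LINE «parity-meter» port, part 2/3: §C the window (joint measurability by truncation, integrability, the pair identity), §D the one-window estimate and the contraction of
# the half-difference (`pair_duhamel_bound`, `pair_step`, `eq_of_near_opposite`, `eq_zero_of_near_opposite`)

Re-homed for the scenario census (typer seat ns-census-typer-1 g9; the cells A2np / A2pe / A2pd / A2pc / A2pb / A2ai are MEMBERS OF RECORD «DECIDED IN KERNEL IN FILES»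
of block A2 since census v1.77 (critic idea-crit-3 PASS 02:53Z; ref ns-census-ref g10 PRE-CHECK ✓ §15.18 item 42; lead-presearch label); this port makes them
TREE-decided): VERBATIM PORT of ns-idea-2 LINE «parity-meter», `pub/ideators/ns-idea-2/lines/parity-meter/line-parity-meter.lean` sha16 d578da454eaab7e9 (775 l.,
lean check rc 0, 0 sorry), split for the 400-line rule into `ScenarioCensusParityMeter` (§A–§B) → `…ParityMeterWindow` (§C–§D) → `…ParityMeterRows` (§E–§G +
census KEYS).  Lean text VERBATIM in namespace `…Theorems.ScenarioCensus.ParityMeter` (the line's `…Lines.ParityMeter` re-homed); port edits: `local notation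
"E3"` → `abbrev E3` (typer lint: no notation in port files), `@[conjecture]` on the OPEN row `Row_A2pm` (typed only), eight one-line docstrings added (gate lint);
the constant `kernelConst` (+ `_pos` / `_spec`), the two `rpow` window integrals, `one_div_sqrt_two_lt_one` and the roughness head `Row_A2os`, which the line shares
VERBATIM with the landed roughness-meter / deviator-meter ports, are taken BY NAME (listed below).  Statements untouched.

No census VALUE is moved here (the cells become TREE-decided by name; booking is the lead's); NS regularity is NOT proved; (L′) ⟨10661⟩ is untouched; no
summit statement is proved by this file. Lemmas that restate already-landed tree declarations are taken BY NAME (gate lint `dedup.landed`): `kernelConst` = `RoughnessMeter.kernelConst`, `kernelConst_pos` = `RoughnessMeter.kernelConst_pos`, `kernelConst_spec` = `RoughnessMeter.kernelConst_spec`, `integrableOn_sub_rpow` = `RoughnessMeter.integrableOn_sub_rpow`, `setIntegral_sub_rpow` = `RoughnessMeter.setIntegral_sub_rpow`, `one_div_sqrt_two_lt_one` = `DeviatorMeter.one_div_sqrt_two_lt_one`, `Row_A2os` = `RoughnessMeter.Row_A2os`.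
-/

-- the summit and its single problem share the name `NavierStokesRegularity` (D-0017 nested layout)
set_option linter.dupNamespace false

noncomputable section

open Set Function Filter Topology Metric MeasureTheory

namespace Summit.NavierStokesRegularity.NavierStokesRegularity.Theorems.ScenarioCensus.ParityMeter

open Literature.Analysis Literature.Analysis.FluidPDE
open Summit.NavierStokesRegularity.NavierStokesRegularity.Theorems.SimilarityEnstrophy
  (typeI_ancient_eq_zero_of_rate_lt_one)
open Summit.NavierStokesRegularity.NavierStokesRegularity.Theorems.SymmetryModuliCountSymmetricLiouville
  (vanishes_of_vanishes_before isTypeIAncientMild_comp_add_right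
    isTypeIAncientMild_conj_linearIsometryEquiv)

/-! ## C. The window: joint measurability by truncation, integrability, the pair identity -/

/-- The truncation of a field to negative times (zero for `τ ≥ 0`). -/
def trunc (u : ℝ → E3 → E3) : ℝ → E3 → E3 := fun τ y => if τ < 0 then u τ y else 0

/-- `trunc u τ = u τ` for `τ < 0`. -/
theorem trunc_of_neg (u : ℝ → E3 → E3) {τ : ℝ} (hτ : τ < 0) : trunc u τ = u τ := by
  funext y; simp [trunc, hτ]

/-- The truncated field of an element of the class is jointly Borel measurable (it is continuous
on the open slab `(-∞, 0) × ℝ³` and zero off it). -/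
theorem measurable_uncurry_trunc {C : ℝ} {u : ℝ → E3 → E3} (h : IsTypeIAncientMild C u) :
    Measurable (uncurry (trunc u)) := by
  classical
  have e : uncurry (trunc u) =
      (Iio (0 : ℝ) ×ˢ (univ : Set E3)).piecewise (uncurry u) (fun _ => 0) := by
    funext p
    rcases p with ⟨τ, y⟩
    by_cases hτ : τ < 0
    · have hm : (τ, y) ∈ Iio (0 : ℝ) ×ˢ (univ : Set E3) := ⟨hτ, mem_univ _⟩
      rw [Set.piecewise_eq_of_mem _ _ _ hm]
      simp [trunc, hτ]
    · have hm : (τ, y) ∉ Iio (0 : ℝ) ×ˢ (univ : Set E3) := fun hp => hτ hp.1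
      rw [Set.piecewise_eq_of_notMem _ _ _ hm]
      simp [trunc, hτ]
  rw [e]
  exact ContinuousOn.measurable_piecewise h.1.continuousOn continuousOn_const
    (measurableSet_Iio.prod MeasurableSet.univ)

/-- **Integrability of the window integrand** `τ ↦ N_{t-τ}[u τ, u τ](x)` on `(s, t)`, `t < 0`,
for an element of the class (tree: `integrableOn_oseenSlice_window`, applied to the truncation). -/
theorem integrableOn_slice_window {C : ℝ} {u : ℝ → E3 → E3} (h : IsTypeIAncientMild C u)
    {s t : ℝ} (ht : t < 0) (x : E3) :
    IntegrableOn (fun τ => oseenSlice (t - τ) (u τ) (u τ) x) (Ioo s t) := by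
  have hs0 : 0 < Real.sqrt (-t) := Real.sqrt_pos.2 (by linarith)
  have hb : ∀ τ ∈ Ioo s t, ∀ y, ‖trunc u τ y‖ ≤ C / Real.sqrt (-t) := by
    intro τ hτ y
    have hτ0 : τ < 0 := hτ.2.trans ht
    rw [trunc_of_neg u hτ0]
    exact (h.norm_le hτ0 y).trans
      (div_le_div_of_nonneg_left h.nonneg hs0 (Real.sqrt_le_sqrt (by linarith [hτ.2])))
  have key := integrableOn_oseenSlice_window (measurable_uncurry_trunc h)
    (measurable_uncurry_trunc h) hb hb x
  refine key.congr_fun (fun τ hτ => ?_) measurableSet_Ioo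
  have hτ0 : τ < 0 := hτ.2.trans ht
  simp only [trunc_of_neg u hτ0]

/-- **The pair identity.**  For two elements `u ∈ A_C`, `w ∈ A_{C'}` of the class and
`s < t < 0`: `u(t) - w(t) = e^{(t-s)Δ}(u(s) - w(s)) - ∫_{(s,t)} (N_{t-τ}[u, u] - N_{t-τ}[w, w]) dτ`. -/
theorem pair_identity {C C' : ℝ} {u w : ℝ → E3 → E3} (hu : IsTypeIAncientMild C u)
    (hw : IsTypeIAncientMild C' w) {s t : ℝ} (hst : s < t) (ht : t < 0) (x : E3) :
    u t x - w t x = heatFlow (fun z => u s z - w s z) (t - s) x -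
      ∫ τ in Ioo s t, (oseenSlice (t - τ) (u τ) (u τ) x - oseenSlice (t - τ) (w τ) (w τ) x) := by
  have hs0 : s < 0 := hst.trans ht
  rw [integral_sub (integrableOn_slice_window hu ht x) (integrableOn_slice_window hw ht x),
    heatFlow_sub_of_bound (hu.continuous_slice hs0) (hw.continuous_slice hs0)
      (fun z => hu.norm_le hs0 z) (fun z => hw.norm_le hs0 z),
    hu.mild_eq_oseenKernel hst ht x, hw.mild_eq_oseenKernel hst ht x]
  simp only [oseenSlice_apply]
  abel

/-! ## D. The one-window estimate and the contraction of the half-difference -/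

-- `integrableOn_sub_rpow`: the line restates the tree's `RoughnessMeter.integrableOn_sub_rpow`; taken BY NAME (gate lint dedup.landed).

-- `setIntegral_sub_rpow`: the line restates the tree's `RoughnessMeter.setIntegral_sub_rpow`; taken BY NAME (gate lint dedup.landed).

/-- **One-window bound for the pair (the engine).**  Let `u ∈ A_C`, `w ∈ A_{C'}`, `t < 0`, and
suppose on ALL slices `τ < 0`: half-difference `√(-τ) ‖u - w‖ ≤ 2M` and sum `√(-τ) ‖u + w‖ ≤ η`.
Then over the memory window `(2t, t)`:
`‖∫_{(2t,t)} (N_{t-τ}[u,u] - N_{t-τ}[w,w]) dτ‖ ≤ 2 K_P · M · η / √(-t)`. -/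
theorem pair_duhamel_bound {C C' : ℝ} {u w : ℝ → E3 → E3} (hu : IsTypeIAncientMild C u)
    (hw : IsTypeIAncientMild C' w) {t : ℝ} (ht : t < 0) {M η : ℝ} (hM0 : 0 ≤ M) (hη0 : 0 ≤ η)
    (hdiff : ∀ τ < 0, ∀ y, Real.sqrt (-τ) * ‖u τ y - w τ y‖ ≤ 2 * M)
    (hsum : ∀ τ < 0, ∀ y, Real.sqrt (-τ) * ‖u τ y + w τ y‖ ≤ η) (x : E3) :
    ‖∫ τ in Ioo (2 * t) t, (oseenSlice (t - τ) (u τ) (u τ) x - oseenSlice (t - τ) (w τ) (w τ) x)‖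
      ≤ 2 * parityConst * M * η / Real.sqrt (-t) := by
  have hs0 : 0 < Real.sqrt (-t) := Real.sqrt_pos.2 (by linarith)
  have hnt : 0 < -t := by linarith
  have hCK := RoughnessMeter.kernelConst_pos
  have hI := parityWeight_pos
  set A : ℝ := M / Real.sqrt (-t) with hA
  set D : ℝ := η / Real.sqrt (-t) with hD
  have hA0 : 0 ≤ A := by positivity
  have hD0 : 0 ≤ D := by positivity
  set r : ℝ := -(1 : ℝ) / 2 with hr
  have hr1 : -1 < r := by rw [hr]; norm_num
  set G : ℝ := 2 * RoughnessMeter.kernelConst * parityWeight * A * D with hG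
  have hG0 : 0 ≤ G := by positivity
  have hpt : ∀ τ ∈ Ioo (2 * t) t,
      ‖oseenSlice (t - τ) (u τ) (u τ) x - oseenSlice (t - τ) (w τ) (w τ) x‖ ≤ G * (t - τ) ^ r := by
    intro τ hτ
    have hτ0 : τ < 0 := hτ.2.trans ht
    have hστ : 0 < t - τ := by linarith [hτ.2]
    have hsτ : 0 < Real.sqrt (-τ) := Real.sqrt_pos.2 (by linarith)
    have hsτt : Real.sqrt (-t) ≤ Real.sqrt (-τ) := Real.sqrt_le_sqrt (by linarith [hτ.2])
    have hAτ : ∀ y, ‖u τ y - w τ y‖ ≤ 2 * A := fun y => by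
      have h1 := hdiff τ hτ0 y
      have h2 : ‖u τ y - w τ y‖ ≤ 2 * M / Real.sqrt (-τ) := by
        rw [le_div_iff₀ hsτ, mul_comm]; exact h1
      refine h2.trans ?_
      rw [hA, mul_div_assoc]
      exact mul_le_mul_of_nonneg_left (div_le_div_of_nonneg_left hM0 hs0 hsτt) (by norm_num)
    have hDτ : ∀ y, ‖u τ y + w τ y‖ ≤ D := fun y => by
      have h1 := hsum τ hτ0 y
      have h2 : ‖u τ y + w τ y‖ ≤ η / Real.sqrt (-τ) := by
        rw [le_div_iff₀ hsτ, mul_comm]; exact h1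
      exact h2.trans (div_le_div_of_nonneg_left hη0 hs0 hsτt)
    have key := slice_pair_bound hστ (hu.continuous_slice hτ0) (hw.continuous_slice hτ0) hA0 hD0
      (fun y => hu.norm_le hτ0 y) (fun y => hw.norm_le hτ0 y) hAτ hDτ x
    rw [hG]
    exact key
  have hint : IntegrableOn (fun τ : ℝ => G * (t - τ) ^ r) (Ioo (2 * t) t) :=
    (RoughnessMeter.integrableOn_sub_rpow ht hr1).const_mul G
  have hle : ‖∫ τ in Ioo (2 * t) t,
      (oseenSlice (t - τ) (u τ) (u τ) x - oseenSlice (t - τ) (w τ) (w τ) x)‖ ≤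
      ∫ τ in Ioo (2 * t) t, G * (t - τ) ^ r :=
    norm_integral_le_of_norm_le hint ((ae_restrict_iff' measurableSet_Ioo).2
      (Eventually.of_forall hpt))
  refine hle.trans ?_
  rw [integral_const_mul, RoughnessMeter.setIntegral_sub_rpow ht hr1]
  have er : r + 1 = 1 / 2 := by rw [hr]; norm_num
  rw [er, show ((-t) ^ (1 / 2 : ℝ)) = Real.sqrt (-t) by rw [Real.sqrt_eq_rpow]]
  rw [hG, hA, hD, parityConst]
  apply le_of_eq
  field_simp

/-- **The contraction step.**  Under the hypotheses of `pair_duhamel_bound` the half-difference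
bound improves: `√(-t) ‖u(t,x) - w(t,x)‖ ≤ 2 (M/√2 + K_P η M)` for every `t < 0`, `x` — the free
part from the slice `2t` carries at most `2M/√(-2t)` (heat contraction), the Duhamel part at most
`2 K_P η M/√(-t)`. -/
theorem pair_step {C C' : ℝ} {u w : ℝ → E3 → E3} (hu : IsTypeIAncientMild C u)
    (hw : IsTypeIAncientMild C' w) {M η : ℝ} (hM0 : 0 ≤ M) (hη0 : 0 ≤ η)
    (hdiff : ∀ τ < 0, ∀ y, Real.sqrt (-τ) * ‖u τ y - w τ y‖ ≤ 2 * M)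
    (hsum : ∀ τ < 0, ∀ y, Real.sqrt (-τ) * ‖u τ y + w τ y‖ ≤ η) :
    ∀ t < 0, ∀ x, Real.sqrt (-t) * ‖u t x - w t x‖ ≤
      2 * (M / Real.sqrt 2 + parityConst * η * M) := by
  intro t ht x
  have hs0 : 0 < Real.sqrt (-t) := Real.sqrt_pos.2 (by linarith)
  have h2t : 2 * t < t := by linarith
  have h2t0 : 2 * t < 0 := by linarith
  have hs2 : 0 < Real.sqrt (-(2 * t)) := Real.sqrt_pos.2 (by linarith)
  -- free part
  have hb : ∀ z, ‖u (2 * t) z - w (2 * t) z‖ ≤ 2 * M / Real.sqrt (-(2 * t)) := fun z => by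
    rw [le_div_iff₀ hs2, mul_comm]; exact hdiff _ h2t0 z
  have hfree : ‖heatFlow (fun z => u (2 * t) z - w (2 * t) z) (t - 2 * t) x‖ ≤
      2 * M / Real.sqrt (-(2 * t)) :=
    norm_heatFlow_le hb _ x
  -- Duhamel part
  have hduh := pair_duhamel_bound hu hw ht hM0 hη0 hdiff hsum x
  -- assemble
  have hu' : ‖u t x - w t x‖ ≤ 2 * M / Real.sqrt (-(2 * t)) + 2 * parityConst * M * η / Real.sqrt (-t) := by
    rw [pair_identity hu hw h2t ht x]
    exact (norm_sub_le _ _).trans (add_le_add hfree hduh)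
  have hsq2 : Real.sqrt (-(2 * t)) = Real.sqrt 2 * Real.sqrt (-t) := by
    rw [show -(2 * t) = 2 * (-t) by ring, Real.sqrt_mul (by norm_num : (0 : ℝ) ≤ 2)]
  have hs2pos : 0 < Real.sqrt 2 := Real.sqrt_pos.2 (by norm_num)
  calc Real.sqrt (-t) * ‖u t x - w t x‖
      ≤ Real.sqrt (-t) * (2 * M / Real.sqrt (-(2 * t)) + 2 * parityConst * M * η / Real.sqrt (-t)) :=
        mul_le_mul_of_nonneg_left hu' hs0.le
    _ = 2 * (M / Real.sqrt 2 + parityConst * η * M) := by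
        rw [hsq2]; field_simp; try ring

/-- **Near-opposite pairs coincide (explicit form).**  Two elements `u ∈ A_C`, `w ∈ A_{C'}` of the
Type-I ancient mild class whose SUM is scale-invariantly small on all slices,
`√(-τ) ‖u(τ,y) + w(τ,y)‖ ≤ η` with `1/√2 + K_P η < 1`, are EQUAL: the half-difference bound `M`
improves to `q M`, `q = 1/√2 + K_P η < 1`, starting from `M = (C + C')/2`. -/
theorem eq_of_near_opposite {C C' : ℝ} {u w : ℝ → E3 → E3} (hu : IsTypeIAncientMild C u)
    (hw : IsTypeIAncientMild C' w) {η : ℝ} (hη0 : 0 ≤ η)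
    (hq : 1 / Real.sqrt 2 + parityConst * η < 1)
    (hsum : ∀ τ < 0, ∀ y, Real.sqrt (-τ) * ‖u τ y + w τ y‖ ≤ η) :
    ∀ t < 0, ∀ x, u t x = w t x := by
  have hC0 : 0 ≤ C := hu.nonneg
  have hC0' : 0 ≤ C' := hw.nonneg
  set q : ℝ := 1 / Real.sqrt 2 + parityConst * η with hqdef
  have hq0 : 0 ≤ q := by
    have := parityConst_pos
    positivity
  set M0 : ℝ := (C + C') / 2 with hM0def
  have hM00 : 0 ≤ M0 := by positivity
  have iter : ∀ n : ℕ, ∀ τ < 0, ∀ y, Real.sqrt (-τ) * ‖u τ y - w τ y‖ ≤ 2 * (q ^ n * M0) := by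
    intro n
    induction n with
    | zero =>
        intro τ hτ y
        have hs : 0 < Real.sqrt (-τ) := Real.sqrt_pos.2 (by linarith)
        have h1 := hu.norm_le hτ y
        have h2 := hw.norm_le hτ y
        have h3 : ‖u τ y - w τ y‖ ≤ C / Real.sqrt (-τ) + C' / Real.sqrt (-τ) :=
          (norm_sub_le _ _).trans (add_le_add h1 h2)
        rw [pow_zero, one_mul, hM0def]
        calc Real.sqrt (-τ) * ‖u τ y - w τ y‖
            ≤ Real.sqrt (-τ) * (C / Real.sqrt (-τ) + C' / Real.sqrt (-τ)) :=
              mul_le_mul_of_nonneg_left h3 hs.le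
          _ = 2 * ((C + C') / 2) := by field_simp
    | succ n ih =>
        intro τ hτ y
        have hMn : 0 ≤ q ^ n * M0 := by positivity
        have step := pair_step hu hw hMn hη0 ih hsum τ hτ y
        refine step.trans (le_of_eq ?_)
        rw [pow_succ, hqdef]
        ring
  intro t ht x
  have hs : 0 < Real.sqrt (-t) := Real.sqrt_pos.2 (by linarith)
  have hlim : Tendsto (fun n : ℕ => 2 * (q ^ n * M0)) atTop (𝓝 0) := by
    have h1 : Tendsto (fun n : ℕ => q ^ n * M0) atTop (𝓝 0) := by
      simpa using (tendsto_pow_atTop_nhds_zero_of_lt_one hq0 hq).mul_const M0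
    simpa using h1.const_mul 2
  have hle : Real.sqrt (-t) * ‖u t x - w t x‖ ≤ 0 :=
    ge_of_tendsto' hlim fun n => iter n t ht x
  have : ‖u t x - w t x‖ ≤ 0 := by
    by_contra hne
    push Not at hne
    have : 0 < Real.sqrt (-t) * ‖u t x - w t x‖ := mul_pos hs hne
    linarith
  exact sub_eq_zero.1 (norm_le_zero_iff.1 this)

/-- **Near-opposite pairs vanish (explicit form).**  If moreover `η < 2`, then `u = w` and
`‖2u‖ = ‖u + w‖ ≤ η/√(-τ)` put `u` in `A_{η/2}` with `η/2 < 1`, and the tree's small-constant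
Liouville theorem (census A2a, `typeI_ancient_eq_zero_of_rate_lt_one`) gives `u ≡ 0`. -/
theorem eq_zero_of_near_opposite {C C' : ℝ} {u w : ℝ → E3 → E3} (hu : IsTypeIAncientMild C u)
    (hw : IsTypeIAncientMild C' w) {η : ℝ} (hη0 : 0 ≤ η) (hη2 : η < 2)
    (hq : 1 / Real.sqrt 2 + parityConst * η < 1)
    (hsum : ∀ τ < 0, ∀ y, Real.sqrt (-τ) * ‖u τ y + w τ y‖ ≤ η) :
    ∀ t < 0, ∀ x, u t x = 0 := by
  have heq := eq_of_near_opposite hu hw hη0 hq hsum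
  have hsmall : IsTypeIAncientMild (η / 2) u := by
    refine ⟨hu.1, hu.2.1, hu.2.2.1, fun t ht x => ?_⟩
    have hs : 0 < Real.sqrt (-t) := Real.sqrt_pos.2 (by linarith)
    have h1 := hsum t ht x
    rw [← heq t ht x, ← two_smul ℝ (u t x), norm_smul, Real.norm_two] at h1
    rw [le_div_iff₀ hs]
    linarith
  exact typeI_ancient_eq_zero_of_rate_lt_one hsmall (by linarith)

end Summit.NavierStokesRegularity.NavierStokesRegularity.Theorems.ScenarioCensus.ParityMeter

end
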